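import Summits.KontsevichZagierPeriods.KontsevichZagierPeriods.Theorems.FurushoPentagonPentagonInKZCornerReps
import Summits.KontsevichZagierPeriods.KontsevichZagierPeriods.Theorems.FurushoPentagonPentagonInKZCornerBlocks
import Literature.NumberTheory.Transcendental.KZDominatedFamilyRelations
import Literature.NumberTheory.Transcendental.NashCubes
import Literature.NumberTheory.Transcendental.SemialgebraicLineDeriv
import Literature.NumberTheory.Transcendental.Associators

/-!
# `PentagonInKZ`, line `edge-normal-newton-leibniz`: corner engine — existence tools (semialgebraicity and bounds)

Part of the proof of `cornerEngine_uniformlyNull` (crux `FurushoPentagon.PentagonInKZ`,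
stmt-KontsevichZagierPeriods-11348), in the ABSTRACT form of the corner engine: all objects (residues `Zq`,
residue monomials `wZ`, letter densities `fd`, `gd`, `dd`, regularised word integrands `Ht`, `Vt`,
`dHt`, `dVt`, insertion operators `op`, `opV`, transports `Af`, `Bf`, `dAf`, `dBf`, defect `F`,
coordinate blocks `Xb | Yb | Θb`) are hypothesised, and their properties form ONE hypothesis
bundle `H`.  This file provides the generic tools for the EXISTENCE of the engine's integral
representations on closed unit cubes (semialgebraicity and boundedness of the integrands):

* `Xb_Yb_Θb_mem`, `sa_Xb`, `sa_Yb`, `sa_Θb` — the coordinate blocks lie in cubes and are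
  semialgebraic (as is every semialgebraic function of the parameter block);
* `sa_Af`, `sa_dBf`, `sa_F` — the transports, the derivative `∂_η B` and the defect, composed with
  semialgebraic blocks and role functions, are semialgebraic;
* `abs_sum_mul_le`, `abs_sum_sum_mul_le` — `|Σ cᵢ gᵢ| ≤ (Σ |cᵢ|) B`;
* `abs_Af_le`, `abs_Bf_le`, `abs_dBf_le` — the transports and the derivative `∂_η B` are bounded on `[0,1]^k × [0,1]^l × [0,α] × [0,β]`; `abs_F_le` — the defect is `O(ξ η)` there (it
  vanishes on both axes and is Lipschitz in each dilation).

(The `O(ξ η)` bounds for the edge differences, the normalisation of the weight and the existence of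
the edge families are in `…CornerEngineExist.lean`.)

References: [KontsevichZagier2001, §1.1–1.2], [BochnakCosteRoy1998, Prop. 2.2.6], [Drinfeld1991, §2].
-/

noncomputable section

open Set MeasureTheory
open Literature.NumberTheory.Transcendental
open Literature.ModelTheory.ExponentialFields (IsSemialgebraic)

namespace Summit.KontsevichZagierPeriods.FurushoPentagon.PentagonInKZ

section AbstractEngine

variable {m N : ℕ} {ℓ ℓ' : Fin (m + 2)} {α β : ℚ}
  {Zq : Fin (m + 2) → (DrinfeldKohnoTrunc ℚ (Fin 4) N)} {wZ : ∀ {n : ℕ}, (Fin n → Fin (m + 2)) → (DrinfeldKohnoTrunc ℚ (Fin 4) N)}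
  {fd gd dd : Fin (m + 2) → ℝ → ℝ → ℝ}
  {Ht Vt dHt dVt : ∀ {n : ℕ}, (Fin n → Fin (m + 2)) → (Fin n → ℝ) → ℝ → ℝ → ℝ}
  {op opV : Fin (m + 2) → (DrinfeldKohnoTrunc ℚ (Fin 4) N) →ₗ[ℚ] (DrinfeldKohnoTrunc ℚ (Fin 4) N)}
  {Af Bf dAf dBf F : ((DrinfeldKohnoTrunc ℚ (Fin 4) N) →ₗ[ℚ] ℚ) → ∀ {k l : ℕ}, (Fin k → ℝ) → (Fin l → ℝ) → ℝ → ℝ → ℝ}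
  {Xb : ∀ k l e : ℕ, (Fin (k + l + e) → ℝ) → Fin k → ℝ}
  {Yb : ∀ k l e : ℕ, (Fin (k + l + e) → ℝ) → Fin l → ℝ}
  {Θb : ∀ k l e : ℕ, (Fin (k + l + e) → ℝ) → Fin e → ℝ}

variable (H :
    (∀ {n : ℕ} (U : Fin n → Fin (m + 2)), wZ U = ((List.ofFn U).map Zq).prod) ∧
    (∀ (a : Fin (m + 2)) (X : (DrinfeldKohnoTrunc ℚ (Fin 4) N)), op a X = if a = ℓ then Zq ℓ * X - X * Zq ℓ else Zq a * X) ∧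
    (∀ (b : Fin (m + 2)) (X : (DrinfeldKohnoTrunc ℚ (Fin 4) N)), opV b X = if b = ℓ' then Zq ℓ' * X - X * Zq ℓ' else Zq b * X) ∧
    (∀ (μ : (DrinfeldKohnoTrunc ℚ (Fin 4) N) →ₗ[ℚ] ℚ) {k l : ℕ} (x : Fin k → ℝ) (y : Fin l → ℝ) (ξ η : ℝ), Af μ x y ξ η = ∑ U : Fin k → Fin (m + 2), ∑ V : Fin l → Fin (m + 2), (μ (wZ U * wZ V) : ℝ) * (Ht U x ξ η * Vt V y 0 η)) ∧
    (∀ (μ : (DrinfeldKohnoTrunc ℚ (Fin 4) N) →ₗ[ℚ] ℚ) {k l : ℕ} (x : Fin k → ℝ) (y : Fin l → ℝ) (ξ η : ℝ), Bf μ x y ξ η = ∑ U : Fin k → Fin (m + 2), ∑ V : Fin l → Fin (m + 2), (μ (wZ V * wZ U) : ℝ) * (Vt V y ξ η * Ht U x ξ 0)) ∧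
    (∀ (μ : (DrinfeldKohnoTrunc ℚ (Fin 4) N) →ₗ[ℚ] ℚ) {k l : ℕ} (x : Fin k → ℝ) (y : Fin l → ℝ) (ξ η : ℝ), dAf μ x y ξ η = ∑ U : Fin k → Fin (m + 2), ∑ V : Fin l → Fin (m + 2), (μ (wZ U * wZ V) : ℝ) * (dHt U x ξ η * Vt V y 0 η)) ∧
    (∀ (μ : (DrinfeldKohnoTrunc ℚ (Fin 4) N) →ₗ[ℚ] ℚ) {k l : ℕ} (x : Fin k → ℝ) (y : Fin l → ℝ) (ξ η : ℝ), dBf μ x y ξ η = ∑ U : Fin k → Fin (m + 2), ∑ V : Fin l → Fin (m + 2), (μ (wZ V * wZ U) : ℝ) * (dVt V y ξ η * Ht U x ξ 0)) ∧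
    (∀ (μ : (DrinfeldKohnoTrunc ℚ (Fin 4) N) →ₗ[ℚ] ℚ) {k l : ℕ} (x : Fin k → ℝ) (y : Fin l → ℝ) (ξ η : ℝ), F μ x y ξ η = Af μ x y ξ η - Bf μ x y ξ η) ∧
    (∀ (k l e : ℕ) (z : Fin (k + l + e) → ℝ), Xb k l e z = fun i => z (Fin.castAdd e (Fin.castAdd l i))) ∧
    (∀ (k l e : ℕ) (z : Fin (k + l + e) → ℝ), Yb k l e z = fun j => z (Fin.castAdd e (Fin.natAdd k j))) ∧
    (∀ (k l e : ℕ) (z : Fin (k + l + e) → ℝ), Θb k l e z = fun s => z (Fin.natAdd (k + l) s)) ∧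
    (∀ (U : Fin 0 → Fin (m + 2)) (x : Fin 0 → ℝ) (ξ η : ℝ), Ht U x ξ η = 1) ∧
    (∀ (V : Fin 0 → Fin (m + 2)) (y : Fin 0 → ℝ) (ξ η : ℝ), Vt V y ξ η = 1) ∧
    (∀ (U : Fin 0 → Fin (m + 2)) (x : Fin 0 → ℝ) (ξ η : ℝ), dHt U x ξ η = 0) ∧
    (∀ (V : Fin 0 → Fin (m + 2)) (y : Fin 0 → ℝ) (ξ η : ℝ), dVt V y ξ η = 0) ∧
    (∀ {k : ℕ} (U : Fin (k + 1) → Fin (m + 2)) (x : Fin (k + 1) → ℝ) (η : ℝ), Ht U x 0 η = 0) ∧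
    (∀ {l : ℕ} (V : Fin (l + 1) → Fin (m + 2)) (y : Fin (l + 1) → ℝ) (ξ : ℝ), Vt V y ξ 0 = 0) ∧
    (∀ t y : ℝ, fd ℓ t y = 1 / t) ∧
    (∀ x s : ℝ, gd ℓ' x s = 1 / s) ∧
    (∀ x y : ℝ, dd ℓ x y = 0) ∧
    (∀ x y : ℝ, dd ℓ' x y = 0) ∧
    (∀ (μ : (DrinfeldKohnoTrunc ℚ (Fin 4) N) →ₗ[ℚ] ℚ) {k : ℕ} (x₀ : ℝ) (x' : Fin k → ℝ) (ξ η : ℝ), ∑ U : Fin (k + 1) → Fin (m + 2), (μ (wZ U) : ℝ) * Ht U (Fin.cons x₀ x') ξ η = (∑ a : Fin (m + 2), (if a = ℓ then 1 / x₀ else ξ * fd a (ξ * x₀) η) * ∑ U' : Fin k → Fin (m + 2), (μ (Zq a * wZ U') : ℝ) * Ht U' x' (ξ * x₀) η) - (1 / x₀) * ∑ U' : Fin k → Fin (m + 2), (μ (wZ U' * Zq ℓ) : ℝ) * Ht U' x' (ξ * x₀) η) ∧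
    (∀ (μ : (DrinfeldKohnoTrunc ℚ (Fin 4) N) →ₗ[ℚ] ℚ) {l : ℕ} (y₀ : ℝ) (y' : Fin l → ℝ) (ξ η : ℝ), ∑ V : Fin (l + 1) → Fin (m + 2), (μ (wZ V) : ℝ) * Vt V (Fin.cons y₀ y') ξ η = (∑ b : Fin (m + 2), (if b = ℓ' then 1 / y₀ else η * gd b ξ (η * y₀)) * ∑ V' : Fin l → Fin (m + 2), (μ (Zq b * wZ V') : ℝ) * Vt V' y' ξ (η * y₀)) - (1 / y₀) * ∑ V' : Fin l → Fin (m + 2), (μ (wZ V' * Zq ℓ') : ℝ) * Vt V' y' ξ (η * y₀)) ∧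
    (∀ (μ : (DrinfeldKohnoTrunc ℚ (Fin 4) N) →ₗ[ℚ] ℚ) {l : ℕ} (P Q : (DrinfeldKohnoTrunc ℚ (Fin 4) N)) (y : Fin l → ℝ) (η : ℝ), (∀ i, 0 < y i ∧ y i < 1) → 0 < η → η ≤ (β : ℝ) → ∑ V : Fin l → Fin (m + 2), (μ (P * (Zq ℓ * wZ V - wZ V * Zq ℓ) * Q) : ℝ) * Vt V y 0 η = 0) ∧
    (∀ (μ : (DrinfeldKohnoTrunc ℚ (Fin 4) N) →ₗ[ℚ] ℚ) {k : ℕ} (P Q : (DrinfeldKohnoTrunc ℚ (Fin 4) N)) (x : Fin k → ℝ) (ξ : ℝ), (∀ i, 0 < x i ∧ x i < 1) → 0 < ξ → ξ ≤ (α : ℝ) → ∑ U : Fin k → Fin (m + 2), (μ (P * (Zq ℓ' * wZ U - wZ U * Zq ℓ') * Q) : ℝ) * Ht U x ξ 0 = 0) ∧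
    (∀ (μ : (DrinfeldKohnoTrunc ℚ (Fin 4) N) →ₗ[ℚ] ℚ) (P Q : (DrinfeldKohnoTrunc ℚ (Fin 4) N)), μ (P * (Zq ℓ * Zq ℓ' - Zq ℓ' * Zq ℓ) * Q) = 0) ∧
    (∀ (μ : (DrinfeldKohnoTrunc ℚ (Fin 4) N) →ₗ[ℚ] ℚ) (P Q : (DrinfeldKohnoTrunc ℚ (Fin 4) N)) (x y : ℝ), 0 < x → x < (α : ℝ) → 0 < y → y < (β : ℝ) → ∑ a : Fin (m + 2), ∑ b : Fin (m + 2), (fd a x y * gd b x y) * (μ (P * (Zq a * Zq b - Zq b * Zq a) * Q) : ℝ) = 0) ∧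
    (∀ (μ : (DrinfeldKohnoTrunc ℚ (Fin 4) N) →ₗ[ℚ] ℚ) (P Q : (DrinfeldKohnoTrunc ℚ (Fin 4) N)) (s : ℝ), 0 < s → s < (β : ℝ) → ∑ b : Fin (m + 2), gd b 0 s * (μ (P * (Zq ℓ * Zq b - Zq b * Zq ℓ) * Q) : ℝ) = 0) ∧
    (∀ (μ : (DrinfeldKohnoTrunc ℚ (Fin 4) N) →ₗ[ℚ] ℚ) (P Q : (DrinfeldKohnoTrunc ℚ (Fin 4) N)) (t : ℝ), 0 < t → t < (α : ℝ) → ∑ a : Fin (m + 2), fd a t 0 * (μ (P * (Zq ℓ' * Zq a - Zq a * Zq ℓ') * Q) : ℝ) = 0) ∧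
    (∀ (a : Fin (m + 2)) (ξ η : ℝ), 0 ≤ ξ → ξ ≤ (α : ℝ) → 0 ≤ η → η ≤ (β : ℝ) → HasDerivAt (fun y => fd a ξ y) (dd a ξ η) η) ∧
    (∀ (b : Fin (m + 2)) (ξ η : ℝ), 0 ≤ ξ → ξ ≤ (α : ℝ) → 0 ≤ η → η ≤ (β : ℝ) → HasDerivAt (fun x => gd b x η) (dd b ξ η) ξ) ∧
    (∀ {k : ℕ} (U : Fin k → Fin (m + 2)) (x : Fin k → ℝ) (ξ η : ℝ), (∀ i, 0 ≤ x i ∧ x i ≤ 1) → 0 ≤ ξ → ξ ≤ (α : ℝ) → 0 ≤ η → η ≤ (β : ℝ) → HasDerivAt (fun t => Ht U x t η) (dHt U x ξ η) ξ) ∧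
    (∀ {l : ℕ} (V : Fin l → Fin (m + 2)) (y : Fin l → ℝ) (ξ η : ℝ), (∀ i, 0 ≤ y i ∧ y i ≤ 1) → 0 ≤ ξ → ξ ≤ (α : ℝ) → 0 ≤ η → η ≤ (β : ℝ) → HasDerivAt (fun s => Vt V y ξ s) (dVt V y ξ η) η) ∧
    (∀ {k : ℕ} (U : Fin (k + 1) → Fin (m + 2)) (x₀ : ℝ) (x' : Fin k → ℝ) (ξ η : ℝ), 0 < x₀ → x₀ < 1 → (∀ i, 0 ≤ x' i ∧ x' i ≤ 1) → 0 ≤ ξ → ξ ≤ (α : ℝ) → 0 ≤ η → η ≤ (β : ℝ) → HasDerivAt (fun t => t * Ht U (Fin.cons t x') ξ η) (ξ * dHt U (Fin.cons x₀ x') ξ η) x₀) ∧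
    (∀ {l : ℕ} (V : Fin (l + 1) → Fin (m + 2)) (y₀ : ℝ) (y' : Fin l → ℝ) (ξ η : ℝ), 0 < y₀ → y₀ < 1 → (∀ i, 0 ≤ y' i ∧ y' i ≤ 1) → 0 ≤ ξ → ξ ≤ (α : ℝ) → 0 ≤ η → η ≤ (β : ℝ) → HasDerivAt (fun t => t * Vt V (Fin.cons t y') ξ η) (η * dVt V (Fin.cons y₀ y') ξ η) y₀) ∧
    (∀ {k : ℕ} (U : Fin (k + 1) → Fin (m + 2)) (x' : Fin k → ℝ) (ξ η : ℝ), (∀ i, 0 ≤ x' i ∧ x' i ≤ 1) → 0 ≤ ξ → ξ ≤ (α : ℝ) → 0 ≤ η → η ≤ (β : ℝ) → ContinuousOn (fun t => t * Ht U (Fin.cons t x') ξ η) (Set.Icc 0 1)) ∧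
    (∀ {l : ℕ} (V : Fin (l + 1) → Fin (m + 2)) (y' : Fin l → ℝ) (ξ η : ℝ), (∀ i, 0 ≤ y' i ∧ y' i ≤ 1) → 0 ≤ ξ → ξ ≤ (α : ℝ) → 0 ≤ η → η ≤ (β : ℝ) → ContinuousOn (fun t => t * Vt V (Fin.cons t y') ξ η) (Set.Icc 0 1)) ∧
    (∀ {d : ℕ} {W : Set (Fin d → ℝ)}, IsSemialgebraic ℚ W → ∀ (a : Fin (m + 2)) {T Y : (Fin d → ℝ) → ℝ}, IsSemialgebraicFunOn ℚ W T → IsSemialgebraicFunOn ℚ W Y → IsSemialgebraicFunOn ℚ W fun z => fd a (T z) (Y z)) ∧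
    (∀ {d : ℕ} {W : Set (Fin d → ℝ)}, IsSemialgebraic ℚ W → ∀ (b : Fin (m + 2)) {T Y : (Fin d → ℝ) → ℝ}, IsSemialgebraicFunOn ℚ W T → IsSemialgebraicFunOn ℚ W Y → IsSemialgebraicFunOn ℚ W fun z => gd b (T z) (Y z)) ∧
    (∀ {d : ℕ} {W : Set (Fin d → ℝ)}, IsSemialgebraic ℚ W → ∀ (a : Fin (m + 2)) {T Y : (Fin d → ℝ) → ℝ}, IsSemialgebraicFunOn ℚ W T → IsSemialgebraicFunOn ℚ W Y → IsSemialgebraicFunOn ℚ W fun z => dd a (T z) (Y z)) ∧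
    (∀ {d : ℕ} {W : Set (Fin d → ℝ)}, IsSemialgebraic ℚ W → ∀ {n : ℕ} (U : Fin n → Fin (m + 2)) {X : (Fin d → ℝ) → Fin n → ℝ} {P Q : (Fin d → ℝ) → ℝ}, (∀ i, IsSemialgebraicFunOn ℚ W fun z => X z i) → IsSemialgebraicFunOn ℚ W P → IsSemialgebraicFunOn ℚ W Q → IsSemialgebraicFunOn ℚ W fun z => Ht U (X z) (P z) (Q z)) ∧
    (∀ {d : ℕ} {W : Set (Fin d → ℝ)}, IsSemialgebraic ℚ W → ∀ {n : ℕ} (V : Fin n → Fin (m + 2)) {Y : (Fin d → ℝ) → Fin n → ℝ} {P Q : (Fin d → ℝ) → ℝ}, (∀ i, IsSemialgebraicFunOn ℚ W fun z => Y z i) → IsSemialgebraicFunOn ℚ W P → IsSemialgebraicFunOn ℚ W Q → IsSemialgebraicFunOn ℚ W fun z => Vt V (Y z) (P z) (Q z)) ∧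
    (∀ {d : ℕ} {W : Set (Fin d → ℝ)}, IsSemialgebraic ℚ W → ∀ {n : ℕ} (U : Fin n → Fin (m + 2)) {X : (Fin d → ℝ) → Fin n → ℝ} {P Q : (Fin d → ℝ) → ℝ}, (∀ i, IsSemialgebraicFunOn ℚ W fun z => X z i) → IsSemialgebraicFunOn ℚ W P → IsSemialgebraicFunOn ℚ W Q → IsSemialgebraicFunOn ℚ W fun z => dHt U (X z) (P z) (Q z)) ∧
    (∀ {d : ℕ} {W : Set (Fin d → ℝ)}, IsSemialgebraic ℚ W → ∀ {n : ℕ} (V : Fin n → Fin (m + 2)) {Y : (Fin d → ℝ) → Fin n → ℝ} {P Q : (Fin d → ℝ) → ℝ}, (∀ i, IsSemialgebraicFunOn ℚ W fun z => Y z i) → IsSemialgebraicFunOn ℚ W P → IsSemialgebraicFunOn ℚ W Q → IsSemialgebraicFunOn ℚ W fun z => dVt V (Y z) (P z) (Q z)) ∧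
    (∃ C : ℝ, ∀ (a : Fin (m + 2)) (ξ η : ℝ), 0 ≤ ξ → ξ ≤ (α : ℝ) → 0 ≤ η → η ≤ (β : ℝ) → (a ≠ ℓ → |fd a ξ η| ≤ C) ∧ (a ≠ ℓ' → |gd a ξ η| ≤ C) ∧ |dd a ξ η| ≤ C ∧ (∀ η' : ℝ, 0 ≤ η' → η' ≤ (β : ℝ) → |fd a ξ η - fd a ξ η'| ≤ C * |η - η'|) ∧ (∀ ξ' : ℝ, 0 ≤ ξ' → ξ' ≤ (α : ℝ) → |gd a ξ η - gd a ξ' η| ≤ C * |ξ - ξ'|)) ∧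
    (∀ k : ℕ, ∃ C : ℝ, ∀ (U : Fin k → Fin (m + 2)) (x : Fin k → ℝ) (ξ η : ℝ), (∀ i, 0 ≤ x i ∧ x i ≤ 1) → 0 ≤ ξ → ξ ≤ (α : ℝ) → 0 ≤ η → η ≤ (β : ℝ) → |Ht U x ξ η| ≤ C ∧ |dHt U x ξ η| ≤ C ∧ (0 < k → |Ht U x ξ η| ≤ C * ξ) ∧ (∀ η' : ℝ, 0 ≤ η' → η' ≤ (β : ℝ) → |Ht U x ξ η - Ht U x ξ η'| ≤ C * ξ * |η - η'|)) ∧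
    (∀ l : ℕ, ∃ C : ℝ, ∀ (V : Fin l → Fin (m + 2)) (y : Fin l → ℝ) (ξ η : ℝ), (∀ i, 0 ≤ y i ∧ y i ≤ 1) → 0 ≤ ξ → ξ ≤ (α : ℝ) → 0 ≤ η → η ≤ (β : ℝ) → |Vt V y ξ η| ≤ C ∧ |dVt V y ξ η| ≤ C ∧ (0 < l → |Vt V y ξ η| ≤ C * η) ∧ (∀ ξ' : ℝ, 0 ≤ ξ' → ξ' ≤ (α : ℝ) → |Vt V y ξ η - Vt V y ξ' η| ≤ C * η * |ξ - ξ'|)))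

/-! ### Two generic tools -/

/-- Composition of a `ℚ`-semialgebraic function with a coordinate projection is `ℚ`-semialgebraic
(private copy of `qe_comp_proj` of `…CornerEngineExistEAux.lean`, to keep this file independent of
it). [cite: BochnakCosteRoy1998, Prop. 2.2.6] -/
private theorem comp_proj {d₁ d₂ : ℕ} (π : Fin d₁ → Fin d₂) {D : Set (Fin d₁ → ℝ)} {g : (Fin d₁ → ℝ) → ℝ}
    (hg : IsSemialgebraicFunOn ℚ D g) {S : Set (Fin d₂ → ℝ)} (hS : IsSemialgebraic ℚ S)
    (hSD : ∀ z ∈ S, (fun i => z (π i)) ∈ D) :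
    IsSemialgebraicFunOn ℚ S (fun z => g (fun i => z (π i))) := by
  rw [isSemialgebraicFunOn_iff] at hg ⊢
  let π' : Fin (d₁ + 1) → Fin (d₂ + 1) := Fin.lastCases (Fin.last d₂) (fun i => Fin.castSucc (π i))
  convert hS.setOf_init_mem.inter (hg.preimage_comp π') using 1
  ext v
  have h1 : Fin.init (v ∘ π') = fun i => Fin.init v (π i) := by ext i; simp [π', Fin.init]
  have h2 : (v ∘ π') (Fin.last d₁) = v (Fin.last d₂) := by simp [π']
  simp only [mem_setOf_eq, mem_inter_iff, mem_preimage, h1, h2]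
  exact ⟨fun h => ⟨h.1, hSD _ h.1, h.2⟩, fun h => ⟨h.1, h.2.2⟩⟩

/-- `|∑ᵢ cᵢ gᵢ| ≤ (∑ᵢ |cᵢ|) · B` as soon as `|gᵢ| ≤ B` termwise. [folklore] -/
theorem abs_sum_mul_le {ι : Type*} (s : Finset ι) (c g : ι → ℝ) (B : ℝ)
    (h : ∀ i ∈ s, |g i| ≤ B) : |∑ i ∈ s, c i * g i| ≤ (∑ i ∈ s, |c i|) * B := by
  rw [Finset.sum_mul]
  refine (Finset.abs_sum_le_sum_abs _ _).trans (Finset.sum_le_sum fun i hi => ?_)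
  rw [abs_mul]
  exact mul_le_mul_of_nonneg_left (h i hi) (abs_nonneg _)

/-! ### The coordinate blocks -/

include H in
/-- The coordinate blocks of a point of the closed cube lie in closed cubes. [folklore] -/
theorem Xb_Yb_Θb_mem {k l e : ℕ} {z : Fin (k + l + e) → ℝ} (hz : z ∈ KZ.cube (k + l + e)) :
    (∀ i, 0 ≤ Xb k l e z i ∧ Xb k l e z i ≤ 1) ∧ (∀ j, 0 ≤ Yb k l e z j ∧ Yb k l e z j ≤ 1) ∧
      Θb k l e z ∈ KZ.cube e := by
  obtain ⟨_, _, _, _, _, _, _, _, hXb, hYb, hΘb, -⟩ := H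
  rw [KZ.mem_cube] at hz
  refine ⟨fun i => ?_, fun j => ?_, ?_⟩
  · rw [hXb]; exact hz _
  · rw [hYb]; exact hz _
  · rw [hΘb]; exact KZ.mem_cube.2 fun s => hz _

include H in
/-- The coordinates of the horizontal block are semialgebraic on the big cube.
[cite: BochnakCosteRoy1998, §2.2] -/
theorem sa_Xb {k l e : ℕ} (i : Fin k) : IsSemialgebraicFunOn ℚ (KZ.cube (k + l + e)) fun z => Xb k l e z i := by
  obtain ⟨_, _, _, _, _, _, _, _, hXb, -⟩ := H
  simp only [hXb]
  exact (isSemialgebraicFunOn_aeval KZ.isSemialgebraic_cube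
    (MvPolynomial.X (Fin.castAdd e (Fin.castAdd l i)) : MvPolynomial _ ℚ)).congr fun z _ => by simp

include H in
/-- The coordinates of the vertical block are semialgebraic on the big cube.
[cite: BochnakCosteRoy1998, §2.2] -/
theorem sa_Yb {k l e : ℕ} (j : Fin l) : IsSemialgebraicFunOn ℚ (KZ.cube (k + l + e)) fun z => Yb k l e z j := by
  obtain ⟨_, _, _, _, _, _, _, _, _, hYb, -⟩ := H
  simp only [hYb]
  exact (isSemialgebraicFunOn_aeval KZ.isSemialgebraic_cube
    (MvPolynomial.X (Fin.castAdd e (Fin.natAdd k j)) : MvPolynomial _ ℚ)).congr fun z _ => by simp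

include H in
/-- A semialgebraic function of the parameters is a semialgebraic function on the big cube.
[cite: BochnakCosteRoy1998, Prop. 2.2.6] -/
theorem sa_Θb {k l e : ℕ} {φ : (Fin e → ℝ) → ℝ} (hφ : IsSemialgebraicFunOn ℚ (KZ.cube e) φ) :
    IsSemialgebraicFunOn ℚ (KZ.cube (k + l + e)) fun z => φ (Θb k l e z) := by
  obtain ⟨_, _, _, _, _, _, _, _, _, _, hΘb, -⟩ := H
  simp only [hΘb]
  exact comp_proj (fun s => Fin.natAdd (k + l) s) hφ KZ.isSemialgebraic_cube fun z hz =>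
    KZ.mem_cube.2 fun s => (KZ.mem_cube.1 hz) _

/-! ### Semialgebraicity of the transports and of the defect -/

/-- The constant `0` is semialgebraic. [cite: BochnakCosteRoy1998, §2.2] -/
theorem sa_zero {d : ℕ} {W : Set (Fin d → ℝ)} (hW : IsSemialgebraic ℚ W) :
    IsSemialgebraicFunOn ℚ W fun _ => (0 : ℝ) :=
  (isSemialgebraicFunOn_const_ratCast hW 0).congr fun _ _ => Rat.cast_zero

include H in
/-- **The transport `A` composed with semialgebraic blocks and role functions is semialgebraic.**
[cite: BochnakCosteRoy1998, Prop. 2.2.6] -/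
theorem sa_Af {d : ℕ} {W : Set (Fin d → ℝ)} (hW : IsSemialgebraic ℚ W)
    (ν : (DrinfeldKohnoTrunc ℚ (Fin 4) N) →ₗ[ℚ] ℚ) {k l : ℕ} {X : (Fin d → ℝ) → Fin k → ℝ}
    {Y : (Fin d → ℝ) → Fin l → ℝ} {P Q : (Fin d → ℝ) → ℝ}
    (hX : ∀ i, IsSemialgebraicFunOn ℚ W fun z => X z i) (hY : ∀ j, IsSemialgebraicFunOn ℚ W fun z => Y z j)
    (hP : IsSemialgebraicFunOn ℚ W P) (hQ : IsSemialgebraicFunOn ℚ W Q) :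
    IsSemialgebraicFunOn ℚ W fun z => Af ν (X z) (Y z) (P z) (Q z) := by
  obtain ⟨_, _, _, hAf, _, _, _, _, _, _, _, _, _, _, _, _, _, _, _, _, _, _, _, _, _, _, _, _, _, _, _, _, _, _,
    _, _, _, _, _, _, hsa_Ht, hsa_Vt, -⟩ := H
  have key : IsSemialgebraicFunOn ℚ W fun z => ∑ U : Fin k → Fin (m + 2), ∑ V : Fin l → Fin (m + 2),
      (ν (wZ U * wZ V) : ℝ) * (Ht U (X z) (P z) (Q z) * Vt V (Y z) 0 (Q z)) :=
    IsSemialgebraicFunOn.fun_finsetSum _ hW fun U _ => IsSemialgebraicFunOn.fun_finsetSum _ hW fun V _ =>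
      (isSemialgebraicFunOn_const_ratCast hW _).fun_mul
        ((hsa_Ht hW U hX hP hQ).fun_mul (hsa_Vt hW V hY (sa_zero hW) hQ))
  exact key.congr fun z _ => (hAf ν (X z) (Y z) (P z) (Q z)).symm

include H in
/-- The transport `B` composed with semialgebraic blocks and role functions is semialgebraic
(private copy of `qe_sa_Bf` of `…CornerEngineExistEAux.lean`). [cite: BochnakCosteRoy1998, Prop. 2.2.6] -/
private theorem sa_Bf {d : ℕ} {W : Set (Fin d → ℝ)} (hW : IsSemialgebraic ℚ W)
    (ν : (DrinfeldKohnoTrunc ℚ (Fin 4) N) →ₗ[ℚ] ℚ) {k l : ℕ} {X : (Fin d → ℝ) → Fin k → ℝ}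
    {Y : (Fin d → ℝ) → Fin l → ℝ} {P Q : (Fin d → ℝ) → ℝ}
    (hX : ∀ i, IsSemialgebraicFunOn ℚ W fun z => X z i) (hY : ∀ j, IsSemialgebraicFunOn ℚ W fun z => Y z j)
    (hP : IsSemialgebraicFunOn ℚ W P) (hQ : IsSemialgebraicFunOn ℚ W Q) :
    IsSemialgebraicFunOn ℚ W fun z => Bf ν (X z) (Y z) (P z) (Q z) := by
  obtain ⟨_, _, _, _, hBf, _, _, _, _, _, _, _, _, _, _, _, _, _, _, _, _, _, _, _, _, _, _, _, _, _, _, _, _, _,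
    _, _, _, _, _, _, hsa_Ht, hsa_Vt, -⟩ := H
  have key : IsSemialgebraicFunOn ℚ W fun z => ∑ U : Fin k → Fin (m + 2), ∑ V : Fin l → Fin (m + 2),
      (ν (wZ V * wZ U) : ℝ) * (Vt V (Y z) (P z) (Q z) * Ht U (X z) (P z) 0) :=
    IsSemialgebraicFunOn.fun_finsetSum _ hW fun U _ => IsSemialgebraicFunOn.fun_finsetSum _ hW fun V _ =>
      (isSemialgebraicFunOn_const_ratCast hW _).fun_mul
        ((hsa_Vt hW V hY hP hQ).fun_mul (hsa_Ht hW U hX hP (sa_zero hW)))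
  exact key.congr fun z _ => (hBf ν (X z) (Y z) (P z) (Q z)).symm

include H in
/-- **The derivative `∂_η B` composed with semialgebraic blocks and role functions is
semialgebraic.** [cite: BochnakCosteRoy1998, Prop. 2.2.6] -/
theorem sa_dBf {d : ℕ} {W : Set (Fin d → ℝ)} (hW : IsSemialgebraic ℚ W)
    (ν : (DrinfeldKohnoTrunc ℚ (Fin 4) N) →ₗ[ℚ] ℚ) {k l : ℕ} {X : (Fin d → ℝ) → Fin k → ℝ}
    {Y : (Fin d → ℝ) → Fin l → ℝ} {P Q : (Fin d → ℝ) → ℝ}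
    (hX : ∀ i, IsSemialgebraicFunOn ℚ W fun z => X z i) (hY : ∀ j, IsSemialgebraicFunOn ℚ W fun z => Y z j)
    (hP : IsSemialgebraicFunOn ℚ W P) (hQ : IsSemialgebraicFunOn ℚ W Q) :
    IsSemialgebraicFunOn ℚ W fun z => dBf ν (X z) (Y z) (P z) (Q z) := by
  obtain ⟨_, _, _, _, _, _, hdBf, _, _, _, _, _, _, _, _, _, _, _, _, _, _, _, _, _, _, _, _, _, _, _, _, _, _, _,
    _, _, _, _, _, _, hsa_Ht, _, _, hsa_dVt, -⟩ := H
  have key : IsSemialgebraicFunOn ℚ W fun z => ∑ U : Fin k → Fin (m + 2), ∑ V : Fin l → Fin (m + 2),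
      (ν (wZ V * wZ U) : ℝ) * (dVt V (Y z) (P z) (Q z) * Ht U (X z) (P z) 0) :=
    IsSemialgebraicFunOn.fun_finsetSum _ hW fun U _ => IsSemialgebraicFunOn.fun_finsetSum _ hW fun V _ =>
      (isSemialgebraicFunOn_const_ratCast hW _).fun_mul
        ((hsa_dVt hW V hY hP hQ).fun_mul (hsa_Ht hW U hX hP (sa_zero hW)))
  exact key.congr fun z _ => (hdBf ν (X z) (Y z) (P z) (Q z)).symm

include H in
/-- **The defect `F = A − B` composed with semialgebraic blocks and role functions is
semialgebraic.** [cite: BochnakCosteRoy1998, Prop. 2.2.6] -/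
theorem sa_F {d : ℕ} {W : Set (Fin d → ℝ)} (hW : IsSemialgebraic ℚ W)
    (ν : (DrinfeldKohnoTrunc ℚ (Fin 4) N) →ₗ[ℚ] ℚ) {k l : ℕ} {X : (Fin d → ℝ) → Fin k → ℝ}
    {Y : (Fin d → ℝ) → Fin l → ℝ} {P Q : (Fin d → ℝ) → ℝ}
    (hX : ∀ i, IsSemialgebraicFunOn ℚ W fun z => X z i) (hY : ∀ j, IsSemialgebraicFunOn ℚ W fun z => Y z j)
    (hP : IsSemialgebraicFunOn ℚ W P) (hQ : IsSemialgebraicFunOn ℚ W Q) :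
    IsSemialgebraicFunOn ℚ W fun z => F ν (X z) (Y z) (P z) (Q z) := by
  have hA := sa_Af H hW ν hX hY hP hQ
  have hB := sa_Bf H hW ν hX hY hP hQ
  obtain ⟨_, _, _, _, _, _, _, hF, -⟩ := H
  exact (hA.fun_sub hB).congr fun z _ => (hF ν (X z) (Y z) (P z) (Q z)).symm

/-! ### Bounds for the transports and the defect -/

/-- `|∑_U ∑_V c_{UV} g_{UV}| ≤ (∑_U ∑_V |c_{UV}|) · B` as soon as `|g_{UV}| ≤ B` termwise. [folklore] -/
theorem abs_sum_sum_mul_le {ι κ : Type*} (s : Finset ι) (t : Finset κ) (c g : ι → κ → ℝ) (B : ℝ)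
    (h : ∀ i ∈ s, ∀ j ∈ t, |g i j| ≤ B) :
    |∑ i ∈ s, ∑ j ∈ t, c i j * g i j| ≤ (∑ i ∈ s, ∑ j ∈ t, |c i j|) * B := by
  rw [Finset.sum_mul]
  refine (Finset.abs_sum_le_sum_abs _ _).trans (Finset.sum_le_sum fun i hi => ?_)
  exact abs_sum_mul_le t (c i) (g i) B (h i hi)

include H in
/-- **`A` is bounded** on `[0,1]^k × [0,1]^l × [0,α] × [0,β]`. [folklore] -/
theorem abs_Af_le (μ : (DrinfeldKohnoTrunc ℚ (Fin 4) N) →ₗ[ℚ] ℚ) (k l : ℕ) :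
    ∃ K : ℝ, 0 ≤ K ∧ ∀ (x : Fin k → ℝ) (y : Fin l → ℝ) (ξ η : ℝ), (∀ i, 0 ≤ x i ∧ x i ≤ 1) →
      (∀ j, 0 ≤ y j ∧ y j ≤ 1) → 0 ≤ ξ → ξ ≤ (α : ℝ) → 0 ≤ η → η ≤ (β : ℝ) → |Af μ x y ξ η| ≤ K := by
  obtain ⟨_, _, _, hAf, _, _, _, _, _, _, _, _, _, _, _, _, _, _, _, _, _, _, _, _, _, _, _, _, _, _, _, _, _, _,
    _, _, _, _, _, _, _, _, _, _, _, hbd_Ht, hbd_Vt⟩ := H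
  obtain ⟨CH, hCH⟩ := hbd_Ht k
  obtain ⟨CV, hCV⟩ := hbd_Vt l
  refine ⟨(∑ U : Fin k → Fin (m + 2), ∑ V : Fin l → Fin (m + 2), |(μ (wZ U * wZ V) : ℝ)|) * (|CH| * |CV|),
    by positivity, fun x y ξ η hx hy hξ0 hξα hη0 hηβ => ?_⟩
  rw [hAf]
  refine abs_sum_sum_mul_le _ _ (fun U V => (μ (wZ U * wZ V) : ℝ)) (fun U V => Ht U x ξ η * Vt V y 0 η) _
    fun U _ V _ => ?_
  rw [abs_mul]
  exact mul_le_mul ((hCH U x ξ η hx hξ0 hξα hη0 hηβ).1.trans (le_abs_self _))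
    ((hCV V y 0 η hy le_rfl (hξ0.trans hξα) hη0 hηβ).1.trans (le_abs_self _)) (abs_nonneg _) (abs_nonneg _)

include H in
/-- **`B` is bounded** on `[0,1]^k × [0,1]^l × [0,α] × [0,β]`. [folklore] -/
theorem abs_Bf_le (μ : (DrinfeldKohnoTrunc ℚ (Fin 4) N) →ₗ[ℚ] ℚ) (k l : ℕ) :
    ∃ K : ℝ, 0 ≤ K ∧ ∀ (x : Fin k → ℝ) (y : Fin l → ℝ) (ξ η : ℝ), (∀ i, 0 ≤ x i ∧ x i ≤ 1) →
      (∀ j, 0 ≤ y j ∧ y j ≤ 1) → 0 ≤ ξ → ξ ≤ (α : ℝ) → 0 ≤ η → η ≤ (β : ℝ) → |Bf μ x y ξ η| ≤ K := by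
  obtain ⟨_, _, _, _, hBf, _, _, _, _, _, _, _, _, _, _, _, _, _, _, _, _, _, _, _, _, _, _, _, _, _, _, _, _, _,
    _, _, _, _, _, _, _, _, _, _, _, hbd_Ht, hbd_Vt⟩ := H
  obtain ⟨CH, hCH⟩ := hbd_Ht k
  obtain ⟨CV, hCV⟩ := hbd_Vt l
  refine ⟨(∑ U : Fin k → Fin (m + 2), ∑ V : Fin l → Fin (m + 2), |(μ (wZ V * wZ U) : ℝ)|) * (|CV| * |CH|),
    by positivity, fun x y ξ η hx hy hξ0 hξα hη0 hηβ => ?_⟩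
  rw [hBf]
  refine abs_sum_sum_mul_le _ _ (fun U V => (μ (wZ V * wZ U) : ℝ)) (fun U V => Vt V y ξ η * Ht U x ξ 0) _
    fun U _ V _ => ?_
  rw [abs_mul]
  exact mul_le_mul ((hCV V y ξ η hy hξ0 hξα hη0 hηβ).1.trans (le_abs_self _))
    ((hCH U x ξ 0 hx hξ0 hξα le_rfl (hη0.trans hηβ)).1.trans (le_abs_self _)) (abs_nonneg _) (abs_nonneg _)

include H in
/-- **`∂_η B` is bounded** on `[0,1]^k × [0,1]^l × [0,α] × [0,β]`. [folklore] -/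
theorem abs_dBf_le (μ : (DrinfeldKohnoTrunc ℚ (Fin 4) N) →ₗ[ℚ] ℚ) (k l : ℕ) :
    ∃ K : ℝ, 0 ≤ K ∧ ∀ (x : Fin k → ℝ) (y : Fin l → ℝ) (ξ η : ℝ), (∀ i, 0 ≤ x i ∧ x i ≤ 1) →
      (∀ j, 0 ≤ y j ∧ y j ≤ 1) → 0 ≤ ξ → ξ ≤ (α : ℝ) → 0 ≤ η → η ≤ (β : ℝ) → |dBf μ x y ξ η| ≤ K := by
  obtain ⟨_, _, _, _, _, _, hdBf, _, _, _, _, _, _, _, _, _, _, _, _, _, _, _, _, _, _, _, _, _, _, _, _, _, _, _,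
    _, _, _, _, _, _, _, _, _, _, _, hbd_Ht, hbd_Vt⟩ := H
  obtain ⟨CH, hCH⟩ := hbd_Ht k
  obtain ⟨CV, hCV⟩ := hbd_Vt l
  refine ⟨(∑ U : Fin k → Fin (m + 2), ∑ V : Fin l → Fin (m + 2), |(μ (wZ V * wZ U) : ℝ)|) * (|CV| * |CH|),
    by positivity, fun x y ξ η hx hy hξ0 hξα hη0 hηβ => ?_⟩
  rw [hdBf]
  refine abs_sum_sum_mul_le _ _ (fun U V => (μ (wZ V * wZ U) : ℝ)) (fun U V => dVt V y ξ η * Ht U x ξ 0) _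
    fun U _ V _ => ?_
  rw [abs_mul]
  exact mul_le_mul ((hCV V y ξ η hy hξ0 hξα hη0 hηβ).2.1.trans (le_abs_self _))
    ((hCH U x ξ 0 hx hξ0 hξα le_rfl (hη0.trans hηβ)).1.trans (le_abs_self _)) (abs_nonneg _) (abs_nonneg _)

include H in
/-- **The defect is `O(ξ η)`**: `|F(x, y; ξ, η)| ≤ K ξ η` on `[0,1]^k × [0,1]^l × [0,α] × [0,β]`
(it vanishes on both axes and is Lipschitz in each dilation). [folklore] -/
theorem abs_F_le (μ : (DrinfeldKohnoTrunc ℚ (Fin 4) N) →ₗ[ℚ] ℚ) (k l : ℕ) :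
    ∃ K : ℝ, 0 ≤ K ∧ ∀ (x : Fin k → ℝ) (y : Fin l → ℝ) (ξ η : ℝ), (∀ i, 0 ≤ x i ∧ x i ≤ 1) →
      (∀ j, 0 ≤ y j ∧ y j ≤ 1) → 0 ≤ ξ → ξ ≤ (α : ℝ) → 0 ≤ η → η ≤ (β : ℝ) →
      |F μ x y ξ η| ≤ K * ξ * η := by
  obtain ⟨hwZ, _, _, hAf, hBf, _, _, hF, _, _, _, hHt_nil, hVt_nil, _, _, _, _, _, _, _, _, _, _, _, _, _, _, _, _,
    _, _, _, _, _, _, _, _, _, _, _, _, _, _, _, _, hbd_Ht, hbd_Vt⟩ := H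
  obtain ⟨CH, hCH⟩ := hbd_Ht k
  obtain ⟨CV, hCV⟩ := hbd_Vt l
  have hwZ0 : ∀ E : Fin 0 → Fin (m + 2), wZ E = 1 := fun E => by
    rw [hwZ, List.ofFn_zero, List.map_nil, List.prod_nil]
  rcases Nat.eq_zero_or_pos l with rfl | hl
  · -- no vertical variables: `F = Σ_U μ(wZ U) (Ht(ξ,η) − Ht(ξ,0))`, transverse Lipschitz bound
    refine ⟨(∑ U : Fin k → Fin (m + 2), |(μ (wZ U) : ℝ)|) * |CH|, by positivity,
      fun x y ξ η hx _ hξ0 hξα hη0 hηβ => ?_⟩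
    have hrew : F μ x y ξ η = ∑ U : Fin k → Fin (m + 2), (μ (wZ U) : ℝ) * (Ht U x ξ η - Ht U x ξ 0) := by
      rw [hF, hAf, hBf, ← Finset.sum_sub_distrib]
      refine Finset.sum_congr rfl fun U _ => ?_
      simp only [Fintype.sum_unique, hwZ0, hVt_nil, mul_one, one_mul, mul_sub]
    rw [hrew]
    refine (abs_sum_mul_le _ _ _ (|CH| * ξ * η) fun U _ => ?_).trans (le_of_eq (by ring))
    have h := (hCH U x ξ η hx hξ0 hξα hη0 hηβ).2.2.2 0 le_rfl (hη0.trans hηβ)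
    rw [sub_zero, abs_of_nonneg hη0] at h
    exact h.trans (mul_le_mul_of_nonneg_right (mul_le_mul_of_nonneg_right (le_abs_self _) hξ0) hη0)
  rcases Nat.eq_zero_or_pos k with rfl | hk
  · -- no horizontal variables: `F = Σ_V μ(wZ V) (Vt(0,η) − Vt(ξ,η))`, Lipschitz bound in `ξ`
    refine ⟨(∑ V : Fin l → Fin (m + 2), |(μ (wZ V) : ℝ)|) * |CV|, by positivity,
      fun x y ξ η _ hy hξ0 hξα hη0 hηβ => ?_⟩
    have hrew : F μ x y ξ η = ∑ V : Fin l → Fin (m + 2), (μ (wZ V) : ℝ) * (Vt V y 0 η - Vt V y ξ η) := by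
      rw [hF, hAf, hBf]
      simp only [Fintype.sum_unique, hwZ0, hHt_nil, mul_one, one_mul, mul_sub, Finset.sum_sub_distrib]
    rw [hrew]
    refine (abs_sum_mul_le _ _ _ (|CV| * ξ * η) fun V _ => ?_).trans (le_of_eq (by ring))
    have h := (hCV V y 0 η hy le_rfl (hξ0.trans hξα) hη0 hηβ).2.2.2 ξ hξ0 hξα
    rw [zero_sub, abs_neg, abs_of_nonneg hξ0] at h
    calc |Vt V y 0 η - Vt V y ξ η| ≤ CV * η * ξ := h
      _ ≤ |CV| * η * ξ := mul_le_mul_of_nonneg_right (mul_le_mul_of_nonneg_right (le_abs_self _) hη0) hξ0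
      _ = |CV| * ξ * η := by ring
  · -- both blocks nonempty: `|F| ≤ |A| + |B|` with `|Ht| ≤ C ξ`, `|Vt| ≤ C η`
    refine ⟨((∑ U : Fin k → Fin (m + 2), ∑ V : Fin l → Fin (m + 2), |(μ (wZ U * wZ V) : ℝ)|) +
        ∑ U : Fin k → Fin (m + 2), ∑ V : Fin l → Fin (m + 2), |(μ (wZ V * wZ U) : ℝ)|) * (|CH| * |CV|),
      by positivity, fun x y ξ η hx hy hξ0 hξα hη0 hηβ => ?_⟩
    have hβ0 : (0 : ℝ) ≤ β := hη0.trans hηβ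
    have hα0 : (0 : ℝ) ≤ α := hξ0.trans hξα
    have hHx : ∀ (U : Fin k → Fin (m + 2)) (η' : ℝ), 0 ≤ η' → η' ≤ (β : ℝ) → |Ht U x ξ η'| ≤ |CH| * ξ :=
      fun U η' h0 h1 => ((hCH U x ξ η' hx hξ0 hξα h0 h1).2.2.1 hk).trans
        (mul_le_mul_of_nonneg_right (le_abs_self _) hξ0)
    have hVy : ∀ (V : Fin l → Fin (m + 2)) (ξ' : ℝ), 0 ≤ ξ' → ξ' ≤ (α : ℝ) → |Vt V y ξ' η| ≤ |CV| * η :=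
      fun V ξ' h0 h1 => ((hCV V y ξ' η hy h0 h1 hη0 hηβ).2.2.1 hl).trans
        (mul_le_mul_of_nonneg_right (le_abs_self _) hη0)
    have hA : |Af μ x y ξ η| ≤ (∑ U : Fin k → Fin (m + 2), ∑ V : Fin l → Fin (m + 2),
        |(μ (wZ U * wZ V) : ℝ)|) * (|CH| * |CV| * ξ * η) := by
      rw [hAf]
      refine abs_sum_sum_mul_le _ _ (fun U V => (μ (wZ U * wZ V) : ℝ)) (fun U V => Ht U x ξ η * Vt V y 0 η) _
        fun U _ V _ => ?_
      rw [abs_mul]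
      calc |Ht U x ξ η| * |Vt V y 0 η| ≤ (|CH| * ξ) * (|CV| * η) :=
          mul_le_mul (hHx U η hη0 hηβ) (hVy V 0 le_rfl hα0) (abs_nonneg _) (by positivity)
        _ = |CH| * |CV| * ξ * η := by ring
    have hB : |Bf μ x y ξ η| ≤ (∑ U : Fin k → Fin (m + 2), ∑ V : Fin l → Fin (m + 2),
        |(μ (wZ V * wZ U) : ℝ)|) * (|CH| * |CV| * ξ * η) := by
      rw [hBf]
      refine abs_sum_sum_mul_le _ _ (fun U V => (μ (wZ V * wZ U) : ℝ)) (fun U V => Vt V y ξ η * Ht U x ξ 0) _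
        fun U _ V _ => ?_
      rw [abs_mul]
      calc |Vt V y ξ η| * |Ht U x ξ 0| ≤ (|CV| * η) * (|CH| * ξ) :=
          mul_le_mul (hVy V ξ hξ0 hξα) (hHx U 0 le_rfl hβ0) (abs_nonneg _) (by positivity)
        _ = |CH| * |CV| * ξ * η := by ring
    rw [hF]
    calc |Af μ x y ξ η - Bf μ x y ξ η| ≤ |Af μ x y ξ η| + |Bf μ x y ξ η| := abs_sub _ _
      _ ≤ _ := add_le_add hA hB
      _ = _ := by ring

end AbstractEngine

/-- **Hook `cornerEngineExistAux_abs_sum_sum_mul_le`** (registered form of `abs_sum_sum_mul_le`):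
`|∑ᵢ ∑ⱼ cᵢⱼ gᵢⱼ| ≤ (∑ᵢ ∑ⱼ |cᵢⱼ|) · B` as soon as `|gᵢⱼ| ≤ B` termwise. [folklore] -/
theorem cornerEngineExistAux_abs_sum_sum_mul_le : ∀ (ι κ : Type) (s : Finset ι) (t : Finset κ) (c g : ι → κ → ℝ) (B : ℝ), (∀ i ∈ s, ∀ j ∈ t, |g i j| ≤ B) → |∑ i ∈ s, ∑ j ∈ t, c i j * g i j| ≤ (∑ i ∈ s, ∑ j ∈ t, |c i j|) * B :=
  fun _ _ s t c g B h => abs_sum_sum_mul_le s t c g B h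

end Summit.KontsevichZagierPeriods.FurushoPentagon.PentagonInKZ
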